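import Literature.Analysis.Fourier.PowerKernelFourierTransform
import Literature.Analysis.SpecialFunctions.BesselKLaplace
import Mathlib.Analysis.SpecialFunctions.JapaneseBracket
import HarnessLib

/-!
# Exponential shell decay of the Fourier transform of the power kernels `(‖v‖² + t²)^{-s}`

Topic `Literature/Analysis/Fourier`, continuing `PowerKernelFourierTransform`
(`fourierIntegral_normSq_add_sq_rpow_neg`: the Schwinger form of `𝓕[(‖·‖² + t²)^{-s}]`) and
`Literature/Analysis/SpecialFunctions/BesselKLaplace` (`integral_rpow_mul_exp_neg_div_sub_mul_sq`:
the cosh substitution). Everything here is PROVED (no named facts, no definitions).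

Let `V` be a finite-dimensional real inner product space of dimension `d`, `s > d/2`.

* `integrable_normSq_add_sq_rpow_neg` — `(‖v‖² + t²)^{-s}` is integrable for `s > d/2`, `t ≠ 0`
  (comparison with Mathlib's `integrable_rpow_neg_one_add_norm_sq`, the Japanese bracket);
* `integral_normSq_add_sq_rpow_neg` — the value at frequency `0` (the integral):
  `∫ (‖v‖² + t²)^{-s} dv = π^{d/2} Γ(s - d/2) / Γ(s) · t^{d - 2s}` (Schwinger form at `w = 0` and
  the Gamma integral `Real.integral_rpow_mul_exp_neg_mul_Ioi`);
* `fourierIntegral_normSq_add_sq_rpow_neg_eq_ofReal` — the transform is real and `≥ 0`;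
* `integral_rpow_mul_exp_neg_div_sub_mul_sq_le` — the one-variable heart of the matter: for
  `A > 0`, `e ≥ -1` and `0 < t₀ ≤ t`,
  `∫₀^∞ μ^e e^{-A/μ - μt²} dμ ≤ e^{-2√A (t - t₀)} ∫₀^∞ μ^e e^{-A/μ - μt₀²} dμ`
  (cosh form `(√A/t)^{e+1} ∫ e^{(e+1)u - 2√A t cosh u} du` and `cosh u ≥ 1`);
* **`norm_fourierIntegral_normSq_add_sq_rpow_neg_le`** — the SHELL BOUND: for `0 < t₀ ≤ t`,
  `‖𝓕[(‖·‖² + t²)^{-s}](w)‖ ≤ (∫ (‖v‖² + t₀²)^{-s} dv) · exp (-2π ‖w‖ (t - t₀))`,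
  uniformly in `w` (from the previous item with `A = π²‖w‖²`; at `w = 0` from monotonicity in
  `t`; and `‖𝓕 f‖ ≤ ‖f‖₁`).

These are the layer (in-plane Fourier mode) bounds behind lattice sums of inverse-power kernels:
the mode of in-plane frequency `w` generated by a layer at vertical distance `t` is
`O(e^{-2π‖w‖t})` uniformly in the shell.

## References

* E. M. Stein, G. Weiss, *Introduction to Fourier Analysis on Euclidean Spaces*, Princeton
  University Press 1971, Ch. I §1 (Gauss–Weierstrass and Poisson kernels by subordination) and
  Ch. IV (Fourier transforms of radial functions). [cite: SteinWeiss1971, Ch. I §1, Ch. IV]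
* G. N. Watson, *A Treatise on the Theory of Bessel Functions*, 2nd ed. (1944), §6.22–6.23
  (the classical evaluation `2 K_ν(2√A t)` of the cosh integral, not used here).
-/

noncomputable section

namespace Literature.Analysis.Fourier

open _root_.MeasureTheory Set Filter
open scoped FourierTransform Real Topology RealInnerProductSpace

variable {V : Type*} [NormedAddCommGroup V] [InnerProductSpace ℝ V] [FiniteDimensional ℝ V]
  [MeasurableSpace V] [BorelSpace V]

/-- The power kernel `(‖v‖² + t²)^{-s}` is integrable on `V` for `s > dim V / 2` and `t ≠ 0`:
it is at most `min(1, t²)^{-s} (1 + ‖v‖²)^{-s}`, and the Japanese bracket `(1 + ‖v‖²)^{-s}` is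
integrable for `2s > dim V` (Mathlib's `integrable_rpow_neg_one_add_norm_sq`). [folklore] -/
theorem integrable_normSq_add_sq_rpow_neg {s t : ℝ} (hs : (Module.finrank ℝ V : ℝ) / 2 < s)
    (ht : t ≠ 0) : Integrable fun v : V => (‖v‖ ^ 2 + t ^ 2) ^ (-s) := by
  have hd0 : (0 : ℝ) ≤ (Module.finrank ℝ V : ℝ) / 2 := by positivity
  have hs0 : 0 < s := hd0.trans_lt hs
  have hs2 : (Module.finrank ℝ V : ℝ) < 2 * s := by linarith
  have ht2 : 0 < t ^ 2 := by positivity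
  have hm : 0 < min 1 (t ^ 2) := lt_min one_pos ht2
  have hm1 : min 1 (t ^ 2) ≤ 1 := min_le_left _ _
  have hmt : min 1 (t ^ 2) ≤ t ^ 2 := min_le_right _ _
  have hJ : Integrable fun v : V => ((1 : ℝ) + ‖v‖ ^ 2) ^ (-s) := by
    have h := integrable_rpow_neg_one_add_norm_sq (μ := (volume : Measure V)) hs2
    refine h.congr (ae_of_all _ fun v => ?_)
    dsimp only
    congr 1
    ring
  refine (hJ.const_mul (min 1 (t ^ 2) ^ (-s))).mono' ?_ (ae_of_all _ fun v => ?_)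
  · exact Measurable.aestronglyMeasurable (by fun_prop)
  · have hv : 0 ≤ ‖v‖ ^ 2 := sq_nonneg _
    have hle : min 1 (t ^ 2) * (1 + ‖v‖ ^ 2) ≤ ‖v‖ ^ 2 + t ^ 2 := by nlinarith
    rw [Real.norm_eq_abs, abs_of_nonneg (Real.rpow_nonneg (by positivity) _),
      ← Real.mul_rpow hm.le (by positivity)]
    exact Real.rpow_le_rpow_of_nonpos (by positivity) hle (by linarith)

/-- **The transform at frequency `0`.** For `s > d/2` and `t > 0`,
`∫ (‖v‖² + t²)^{-s} dv = π^{d/2} Γ(s - d/2) / Γ(s) · t^{d - 2s}` (`d = dim V`): the Schwinger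
form `π^{d/2} Γ(s)⁻¹ ∫₀^∞ μ^{s-1-d/2} e^{-μt²} dμ` of `𝓕[(‖·‖² + t²)^{-s}](0) = ∫ (‖v‖² + t²)^{-s}`
and the Gamma integral `∫₀^∞ μ^{a-1} e^{-rμ} dμ = r^{-a} Γ(a)`. [folklore] -/
theorem integral_normSq_add_sq_rpow_neg {s t : ℝ} (hs : (Module.finrank ℝ V : ℝ) / 2 < s)
    (ht : 0 < t) :
    ∫ v : V, (‖v‖ ^ 2 + t ^ 2) ^ (-s) =
      Real.pi ^ ((Module.finrank ℝ V : ℝ) / 2) * Real.Gamma (s - (Module.finrank ℝ V : ℝ) / 2) /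
        Real.Gamma s * t ^ ((Module.finrank ℝ V : ℝ) - 2 * s) := by
  have hν : 0 < s - (Module.finrank ℝ V : ℝ) / 2 := by linarith
  have ht2 : 0 < t ^ 2 := by positivity
  -- the Schwinger form at frequency `0`
  have h := fourierIntegral_normSq_add_sq_rpow_neg hs ht (0 : V)
  rw [Real.fourier_eq] at h
  simp only [inner_zero_right, neg_zero, AddChar.map_zero_eq_one, one_smul,
    integral_complex_ofReal, Complex.ofReal_inj] at h
  rw [h]
  -- the `μ`-integral is a Gamma integral
  have hI : ∫ μ in Ioi (0 : ℝ), μ ^ (s - 1 - (Module.finrank ℝ V : ℝ) / 2) *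
      Real.exp (-(Real.pi ^ 2 * ‖(0 : V)‖ ^ 2 / μ) - μ * t ^ 2) =
      (1 / t ^ 2) ^ (s - (Module.finrank ℝ V : ℝ) / 2) *
        Real.Gamma (s - (Module.finrank ℝ V : ℝ) / 2) := by
    rw [← Real.integral_rpow_mul_exp_neg_mul_Ioi hν ht2]
    refine setIntegral_congr_fun measurableSet_Ioi fun μ _ => ?_
    rw [norm_zero]
    congr 2 <;> ring
  have e : (1 / t ^ 2) ^ (s - (Module.finrank ℝ V : ℝ) / 2) =
      t ^ ((Module.finrank ℝ V : ℝ) - 2 * s) := by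
    rw [one_div, Real.inv_rpow ht2.le, ← Real.rpow_neg ht2.le, ← Real.rpow_two,
      ← Real.rpow_mul ht.le]
    congr 1
    ring
  rw [hI, e]
  ring

/-- The Schwinger form `π^{d/2} Γ(s)⁻¹ ∫₀^∞ μ^{s-1-d/2} e^{-π²‖w‖²/μ - μt²} dμ` of the Fourier
transform of the power kernel is nonnegative (for `s > d/2`, so that `Γ(s) > 0`). [folklore] -/
theorem schwingerForm_nonneg {V : Type*} [NormedAddCommGroup V] [InnerProductSpace ℝ V]
    {s : ℝ} (hs : (Module.finrank ℝ V : ℝ) / 2 < s) (t : ℝ) (w : V) :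
    0 ≤ Real.pi ^ ((Module.finrank ℝ V : ℝ) / 2) / Real.Gamma s *
        ∫ μ in Set.Ioi (0 : ℝ), μ ^ (s - 1 - (Module.finrank ℝ V : ℝ) / 2) *
          Real.exp (-(Real.pi ^ 2 * ‖w‖ ^ 2 / μ) - μ * t ^ 2) := by
  have hd0 : (0 : ℝ) ≤ (Module.finrank ℝ V : ℝ) / 2 := by positivity
  have hs0 : 0 < s := hd0.trans_lt hs
  refine mul_nonneg (div_nonneg (by positivity) (Real.Gamma_pos_of_pos hs0).le)
    (setIntegral_nonneg measurableSet_Ioi fun μ hμ => ?_)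
  have hμ : (0 : ℝ) < μ := hμ
  positivity

/-- The Fourier transform of the power kernel `(‖v‖² + t²)^{-s}` (`s > d/2`, `t > 0`) is real
and nonnegative: it is its Schwinger form, an integral of positive quantities. [folklore] -/
theorem fourierIntegral_normSq_add_sq_rpow_neg_eq_ofReal {s t : ℝ}
    (hs : (Module.finrank ℝ V : ℝ) / 2 < s) (ht : 0 < t) (w : V) :
    ∃ r : ℝ, 0 ≤ r ∧ 𝓕 (fun v : V => (((‖v‖ ^ 2 + t ^ 2) ^ (-s) : ℝ) : ℂ)) w = (r : ℂ) :=
  ⟨_, schwingerForm_nonneg hs t w, fourierIntegral_normSq_add_sq_rpow_neg hs ht w⟩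

/-- The norm of the Fourier transform of the power kernel is at most its integral
(`‖𝓕 f‖_∞ ≤ ‖f‖₁` for the nonnegative function `f = (‖·‖² + t²)^{-s}`). [folklore] -/
theorem norm_fourierIntegral_normSq_add_sq_rpow_neg_le_integral (s t : ℝ) (w : V) :
    ‖𝓕 (fun v : V => (((‖v‖ ^ 2 + t ^ 2) ^ (-s) : ℝ) : ℂ)) w‖ ≤
      ∫ v : V, (‖v‖ ^ 2 + t ^ 2) ^ (-s) := by
  rw [Real.fourier_eq]
  refine (norm_integral_le_integral_norm _).trans (le_of_eq ?_)
  refine integral_congr_ae (ae_of_all _ fun v => ?_)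
  dsimp only
  rw [Circle.norm_smul, Complex.norm_real, Real.norm_eq_abs,
    abs_of_nonneg (Real.rpow_nonneg (by positivity) _)]

/-- **The shell bound for the Schwinger-parametrised kernel.** For `A > 0`, `e ≥ -1` and
`0 < t₀ ≤ t`,
`∫₀^∞ μ^e e^{-A/μ - μt²} dμ ≤ e^{-2√A (t - t₀)} ∫₀^∞ μ^e e^{-A/μ - μt₀²} dμ`.
With `ν = e + 1 ≥ 0`, the cosh substitution (`integral_rpow_mul_exp_neg_div_sub_mul_sq`) writes
the left side as `(√A/t)^ν ∫ e^{νu - 2√A t cosh u} du`; now `(√A/t)^ν ≤ (√A/t₀)^ν` and, since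
`cosh u ≥ 1`, `2√A t cosh u ≥ 2√A t₀ cosh u + 2√A (t - t₀)`. (Classically: the monotonicity
`K_ν(x) e^{x}` decreasing, Watson §6.22–6.23.) [folklore] -/
theorem integral_rpow_mul_exp_neg_div_sub_mul_sq_le {A e t₀ t : ℝ} (hA : 0 < A)
    (he : 0 ≤ e + 1) (ht₀ : 0 < t₀) (ht : t₀ ≤ t) :
    ∫ μ in Set.Ioi (0 : ℝ), μ ^ e * Real.exp (-(A / μ) - μ * t ^ 2) ≤
      Real.exp (-(2 * Real.sqrt A * (t - t₀))) *
        ∫ μ in Set.Ioi (0 : ℝ), μ ^ e * Real.exp (-(A / μ) - μ * t₀ ^ 2) := by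
  have ht' : 0 < t := ht₀.trans_le ht
  obtain ⟨ν, rfl⟩ : ∃ ν : ℝ, e = ν - 1 := ⟨e + 1, by ring⟩
  have hν : 0 ≤ ν := by linarith
  have hr0 : 0 < Real.sqrt A := Real.sqrt_pos.2 hA
  rw [Literature.Analysis.SpecialFunctions.integral_rpow_mul_exp_neg_div_sub_mul_sq hA ht' ν,
    Literature.Analysis.SpecialFunctions.integral_rpow_mul_exp_neg_div_sub_mul_sq hA ht₀ ν]
  -- the cosh integrals: pointwise comparison using `cosh u ≥ 1`
  have hJle : ∫ u : ℝ, Real.exp (ν * u - 2 * Real.sqrt A * t * Real.cosh u) ≤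
      Real.exp (-(2 * Real.sqrt A * (t - t₀))) *
        ∫ u : ℝ, Real.exp (ν * u - 2 * Real.sqrt A * t₀ * Real.cosh u) := by
    rw [← integral_const_mul]
    refine integral_mono
      (Literature.Analysis.SpecialFunctions.integrable_exp_mul_sub_mul_cosh ν (by positivity))
      ((Literature.Analysis.SpecialFunctions.integrable_exp_mul_sub_mul_cosh ν
        (by positivity)).const_mul _) fun u => ?_
    dsimp only
    rw [← Real.exp_add]
    refine Real.exp_le_exp.2 ?_
    have h1 : 0 ≤ 2 * Real.sqrt A * (t - t₀) * (Real.cosh u - 1) :=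
      mul_nonneg (mul_nonneg (by positivity) (sub_nonneg.2 ht))
        (sub_nonneg.2 (Real.one_le_cosh u))
    nlinarith [h1]
  have hJ0 : 0 ≤ ∫ u : ℝ, Real.exp (ν * u - 2 * Real.sqrt A * t * Real.cosh u) :=
    integral_nonneg fun u => (Real.exp_pos _).le
  have hpow : (Real.sqrt A / t) ^ ν ≤ (Real.sqrt A / t₀) ^ ν :=
    Real.rpow_le_rpow (by positivity) (div_le_div_of_nonneg_left hr0.le ht₀ ht) hν
  calc (Real.sqrt A / t) ^ ν * ∫ u : ℝ, Real.exp (ν * u - 2 * Real.sqrt A * t * Real.cosh u)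
      ≤ (Real.sqrt A / t₀) ^ ν * (Real.exp (-(2 * Real.sqrt A * (t - t₀))) *
          ∫ u : ℝ, Real.exp (ν * u - 2 * Real.sqrt A * t₀ * Real.cosh u)) :=
        mul_le_mul hpow hJle hJ0 (by positivity)
    _ = _ := by ring

/-- **Shell bound.** For `s > d/2`, `0 < t₀ ≤ t` and every frequency `w`,
`‖𝓕[(‖·‖² + t²)^{-s}](w)‖ ≤ (∫ (‖v‖² + t₀²)^{-s} dv) · exp (-2π ‖w‖ (t - t₀))`.
For `w ≠ 0`: the Schwinger form (`fourierIntegral_normSq_add_sq_rpow_neg`) and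
`integral_rpow_mul_exp_neg_div_sub_mul_sq_le` with `A = π²‖w‖²` give
`𝓕[…t…](w) ≤ e^{-2π‖w‖(t - t₀)} 𝓕[…t₀…](w)`, and `𝓕[…t₀…](w) ≤ ∫ (‖v‖² + t₀²)^{-s}`; for
`w = 0` it is the monotonicity of `t ↦ ∫ (‖v‖² + t²)^{-s}`.
[cite: SteinWeiss1971, Ch. I §1] [folklore] -/
theorem norm_fourierIntegral_normSq_add_sq_rpow_neg_le {s t₀ t : ℝ}
    (hs : (Module.finrank ℝ V : ℝ) / 2 < s) (ht₀ : 0 < t₀) (ht : t₀ ≤ t) (w : V) :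
    ‖𝓕 (fun v : V => (((‖v‖ ^ 2 + t ^ 2) ^ (-s) : ℝ) : ℂ)) w‖ ≤
      (∫ v : V, (‖v‖ ^ 2 + t₀ ^ 2) ^ (-s)) * Real.exp (-(2 * Real.pi * ‖w‖ * (t - t₀))) := by
  have hd0 : (0 : ℝ) ≤ (Module.finrank ℝ V : ℝ) / 2 := by positivity
  have hs0 : 0 < s := hd0.trans_lt hs
  have ht' : 0 < t := ht₀.trans_le ht
  by_cases hw : w = 0
  · -- frequency `0`: monotonicity in `t`
    subst hw
    rw [norm_zero, mul_zero, zero_mul, neg_zero, Real.exp_zero, mul_one]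
    refine (norm_fourierIntegral_normSq_add_sq_rpow_neg_le_integral s t 0).trans
      (integral_mono_of_nonneg (ae_of_all _ fun v => ?_)
        (integrable_normSq_add_sq_rpow_neg hs ht₀.ne') (ae_of_all _ fun v => ?_))
    · exact Real.rpow_nonneg (by positivity) _
    · dsimp only
      refine Real.rpow_le_rpow_of_nonpos (by positivity) ?_ (by linarith)
      nlinarith
  · -- frequency `w ≠ 0`: the cosh form
    have hw' : 0 < ‖w‖ := norm_pos_iff.2 hw
    have hA : 0 < Real.pi ^ 2 * ‖w‖ ^ 2 := by positivity
    have hsq : Real.sqrt (Real.pi ^ 2 * ‖w‖ ^ 2) = Real.pi * ‖w‖ := by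
      rw [show Real.pi ^ 2 * ‖w‖ ^ 2 = (Real.pi * ‖w‖) ^ 2 by ring,
        Real.sqrt_sq (by positivity)]
    have hc0 : 0 ≤ Real.pi ^ ((Module.finrank ℝ V : ℝ) / 2) / Real.Gamma s :=
      div_nonneg (by positivity) (Real.Gamma_pos_of_pos hs0).le
    -- the norm of the transform is its (nonnegative) Schwinger form
    have hnorm : ∀ τ : ℝ, 0 < τ →
        ‖𝓕 (fun v : V => (((‖v‖ ^ 2 + τ ^ 2) ^ (-s) : ℝ) : ℂ)) w‖ =
          Real.pi ^ ((Module.finrank ℝ V : ℝ) / 2) / Real.Gamma s *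
            ∫ μ in Set.Ioi (0 : ℝ), μ ^ (s - 1 - (Module.finrank ℝ V : ℝ) / 2) *
              Real.exp (-(Real.pi ^ 2 * ‖w‖ ^ 2 / μ) - μ * τ ^ 2) := by
      intro τ hτ
      rw [fourierIntegral_normSq_add_sq_rpow_neg hs hτ w, Complex.norm_real, Real.norm_eq_abs,
        abs_of_nonneg (schwingerForm_nonneg hs τ w)]
    -- the shell bound for the `μ`-integrals
    have hkey := integral_rpow_mul_exp_neg_div_sub_mul_sq_le
      (e := s - 1 - (Module.finrank ℝ V : ℝ) / 2) hA (by linarith) ht₀ ht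
    rw [hsq, show 2 * (Real.pi * ‖w‖) * (t - t₀) = 2 * Real.pi * ‖w‖ * (t - t₀) by ring] at hkey
    calc ‖𝓕 (fun v : V => (((‖v‖ ^ 2 + t ^ 2) ^ (-s) : ℝ) : ℂ)) w‖
        = Real.pi ^ ((Module.finrank ℝ V : ℝ) / 2) / Real.Gamma s *
            ∫ μ in Set.Ioi (0 : ℝ), μ ^ (s - 1 - (Module.finrank ℝ V : ℝ) / 2) *
              Real.exp (-(Real.pi ^ 2 * ‖w‖ ^ 2 / μ) - μ * t ^ 2) := hnorm t ht'
      _ ≤ Real.pi ^ ((Module.finrank ℝ V : ℝ) / 2) / Real.Gamma s *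
            (Real.exp (-(2 * Real.pi * ‖w‖ * (t - t₀))) *
              ∫ μ in Set.Ioi (0 : ℝ), μ ^ (s - 1 - (Module.finrank ℝ V : ℝ) / 2) *
                Real.exp (-(Real.pi ^ 2 * ‖w‖ ^ 2 / μ) - μ * t₀ ^ 2)) :=
          mul_le_mul_of_nonneg_left hkey hc0
      _ = ‖𝓕 (fun v : V => (((‖v‖ ^ 2 + t₀ ^ 2) ^ (-s) : ℝ) : ℂ)) w‖ *
            Real.exp (-(2 * Real.pi * ‖w‖ * (t - t₀))) := by
          rw [hnorm t₀ ht₀]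
          ring
      _ ≤ _ := mul_le_mul_of_nonneg_right
          (norm_fourierIntegral_normSq_add_sq_rpow_neg_le_integral s t₀ w) (Real.exp_pos _).le

end Literature.Analysis.Fourier
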